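import Summits.AtomisticToContinuum.Crystallization.Theorems.ThreeConeCertificateSlackRigidityRodLemmaA

/-!
# The 1-D spectral lemma of line `signed-root-silent-field` — part B: annihilation on good intervals
# and over the half-integer grid

The registered stub `stub_rodLemma` (skeleton `Cruxes/SlackRigidity/Lines/signed-root-silent-field.lean`,
lead c2; crux `SlackRigidity`, stmt-AtomisticToContinuum-11960): a bounded sequence `u : ℤ → ℂ` with
`Σ_k u_k c(t − kh) = 0` for all real `t`, where `c` is continuous, `O((1+|t|)⁻²)`, and `𝓕c` is `C²`
and zero-free on `(1/(2h), 1/h) ∪ (−1/h, −1/(2h))`, is `2`-periodic.  Proof WITHOUT Wiener division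
or distributions: test the identity against `𝓕(φ/𝓕c)` (multiplication formula) to annihilate every
`C_c²` test function supported in a good interval; integer translates of the two good intervals cover
`ℝ ∖ ½ℤ`; shrinking bumps extend the annihilation to test functions with vanishing `2`-jets on `½ℤ`;
pairing with `𝐞(k₀·)(𝐞(2·) − 1)³ Q₀` (`𝓕Q₀|_ℤ = q δ₀`) gives a vanishing third difference of
`n ↦ u(k₀ + 2n)`, and a bounded sequence with vanishing third difference is constant.
All `[folklore]` (Rudin, *Functional Analysis* Thm 9.3; Katznelson, *Harmonic Analysis* Ch. VI).

This part: `Σ_k u_k 𝓕φ(k) = 0` for `φ ∈ C_c²` supported in a good interval (or an integer translate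
of one), and for grid-avoiding `φ` by splitting `φ` into its pieces on the half-intervals
`(m/2, (m+1)/2)`.
-/

noncomputable section

open scoped BigOperators Topology FourierTransform Real
open MeasureTheory Filter Set Complex

namespace Summit.AtomisticToContinuum.Crystallization.Theorems.SignedRootRodLemma

/-! ## Small Fourier facts on `ℝ` -/

/-- The flipped pairing gives the same Fourier transform on `ℝ` (the inner product is symmetric).
[folklore] -/
theorem fourierIntegral_flip_eq (f : ℝ → ℂ) (x : ℝ) :
    VectorFourier.fourierIntegral 𝐞 volume (innerₗ ℝ).flip f x = 𝓕 f x := by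
  rw [Real.fourier_eq, VectorFourier.fourierIntegral]
  congr 1
  funext v
  simp only [LinearMap.flip_apply, innerₗ_apply_apply, real_inner_comm]

/-- **Multiplication formula** on `ℝ`: `∫ 𝓕g · f = ∫ g · 𝓕f` for integrable `f, g`. [folklore] -/
theorem integral_fourier_mul_eq (f g : ℝ → ℂ) (hf : Integrable f) (hg : Integrable g) :
    ∫ t, 𝓕 g t * f t = ∫ x, g x * 𝓕 f x := by
  have h := VectorFourier.integral_fourierIntegral_smul_eq_flip (μ := volume) (ν := volume)
    (L := innerₗ ℝ) (f := g) (g := f) Real.continuous_fourierChar (by exact continuous_inner) hg hf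
  simp only [smul_eq_mul] at h
  have h' : ∫ x, g x * VectorFourier.fourierIntegral 𝐞 volume (innerₗ ℝ).flip f x =
      ∫ x, g x * 𝓕 f x := by
    congr 1
    funext x
    rw [fourierIntegral_flip_eq]
  rw [← h', ← h]
  rfl

/-- Fourier transform of an integer... no: of a translate, `𝓕(f(· − k))(ξ) = 𝐞(−kξ) 𝓕f(ξ)`. [folklore] -/
theorem fourier_comp_sub_const (f : ℝ → ℂ) (k ξ : ℝ) :
    𝓕 (fun t => f (t - k)) ξ = 𝐞 (-(ξ * k)) * 𝓕 f ξ := by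
  have h := VectorFourier.fourierIntegral_comp_add_right 𝐞 volume (innerₗ ℝ) f (-k)
  have h1 : (fun t => f (t - k)) = f ∘ fun v => v + -k := by
    funext t
    simp [sub_eq_add_neg]
  rw [show 𝓕 (fun t => f (t - k)) = VectorFourier.fourierIntegral 𝐞 volume (innerₗ ℝ)
      (fun t => f (t - k)) from rfl, h1, h]
  simp only [innerₗ_apply_apply, Real.inner_apply, Circle.smul_def, smul_eq_mul, neg_mul,
    mul_comm ξ k]
  rfl

/-- Fourier transform of an integer translate at an integer: `𝓕(φ(· + n))(k) = 𝓕φ(k)`. [folklore] -/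
theorem fourier_comp_add_int (φ : ℝ → ℂ) (n k : ℤ) :
    𝓕 (fun t => φ (t + n)) k = 𝓕 φ k := by
  have h := fourier_comp_sub_const φ (-(n : ℝ)) k
  simp only [sub_neg_eq_add] at h
  rw [h]
  have : (𝐞 (-((k : ℝ) * -(n : ℝ))) : ℂ) = 1 := by
    rw [Real.fourierChar_apply]
    have : (↑(2 * π * -((k : ℝ) * -(n : ℝ))) * I : ℂ) = ((k * n : ℤ) : ℂ) * (2 * π * I) := by
      push_cast; ring
    rw [this]
    exact Complex.exp_int_mul_two_pi_mul_I (k * n)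
  rw [this, one_mul]

/-! ## Dividing a test function by the symbol -/

/-- **The quotient `φ/m` is `C²` with compact support** when `φ ∈ C_c²` has `tsupport φ ⊆ J`, `J` open,
and `m` is `C²` and zero-free on `J`. [folklore] -/
theorem contDiff_div_of_tsupport_subset {φ m : ℝ → ℂ} {J : Set ℝ} (hJ : IsOpen J)
    (hφ : ContDiff ℝ 2 φ) (hφJ : tsupport φ ⊆ J) (hm : ContDiffOn ℝ 2 m J)
    (hm0 : ∀ ξ ∈ J, m ξ ≠ 0) :
    ContDiff ℝ 2 (fun ξ => φ ξ * (m ξ)⁻¹) := by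
  refine contDiff_iff_contDiffAt.2 fun x => ?_
  by_cases hx : x ∈ J
  · have h1 : ContDiffOn ℝ 2 (fun ξ => φ ξ * (m ξ)⁻¹) J :=
      hφ.contDiffOn.mul (hm.inv hm0)
    exact h1.contDiffAt (hJ.mem_nhds hx)
  · have hx' : x ∉ tsupport φ := fun h => hx (hφJ h)
    have h0 : φ =ᶠ[𝓝 x] 0 := notMem_tsupport_iff_eventuallyEq.mp hx'
    have h1 : (fun ξ => φ ξ * (m ξ)⁻¹) =ᶠ[𝓝 x] fun _ => 0 := by
      filter_upwards [h0] with y hy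
      simp [hy]
    exact (contDiffAt_const (c := (0 : ℂ))).congr_of_eventuallyEq h1

/-- The quotient has compact support. [folklore] -/
theorem hasCompactSupport_div {φ m : ℝ → ℂ} (hφs : HasCompactSupport φ) :
    HasCompactSupport (fun ξ => φ ξ * (m ξ)⁻¹) :=
  hφs.mul_right (f' := fun ξ => (m ξ)⁻¹)

/-! ## Annihilation of test functions supported in a good interval -/

/-- **Annihilation on a good set.**  Let `u` be bounded, `c` continuous with `‖c(t)‖ ≤ C(1+|t|)⁻²`,
`Σ_k u_k c(t − k) = 0` for all real `t`, and let `J` be an open set on which `𝓕c` is `C²` and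
zero-free.  Then `Σ_k u_k 𝓕φ(k) = 0` for every `C²` function `φ` with compact support and
`tsupport φ ⊆ J`. [folklore] -/
theorem hasSum_mul_fourier_of_tsupport_subset {u : ℤ → ℂ} {c : ℝ → ℂ} {M C : ℝ}
    (hu : ∀ k, ‖u k‖ ≤ M) (hc : Continuous c) (hcd : ∀ t : ℝ, ‖c t‖ ≤ C / (1 + |t|) ^ 2)
    (hsum : ∀ t : ℝ, HasSum (fun k : ℤ => u k * c (t - k)) 0)
    {J : Set ℝ} (hJ : IsOpen J) (hm : ContDiffOn ℝ 2 (𝓕 c) J) (hm0 : ∀ ξ ∈ J, 𝓕 c ξ ≠ 0)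
    {φ : ℝ → ℂ} (hφ : ContDiff ℝ 2 φ) (hφs : HasCompactSupport φ) (hφJ : tsupport φ ⊆ J) :
    HasSum (fun k : ℤ => u k * 𝓕 φ k) 0 := by
  -- integrability of `c` and its translates
  have hC : 0 ≤ C := by
    have h := hcd 0
    simp only [abs_zero, add_zero, one_pow, div_one] at h
    exact (norm_nonneg _).trans h
  have hci : Integrable c := by
    refine Integrable.mono' (integrable_inv_one_add_sq.const_mul (2 * C)) hc.aestronglyMeasurable
      (Eventually.of_forall fun t => (hcd t).trans ?_)
    have h1 : 1 + t ^ 2 ≤ 2 * (1 + |t|) ^ 2 := by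
      have : |t| ^ 2 = t ^ 2 := sq_abs t
      nlinarith [abs_nonneg t]
    rw [div_le_iff₀ (by positivity)]
    calc C = 2 * C * (1 + t ^ 2)⁻¹ * ((1 + t ^ 2) / 2) := by field_simp
      _ ≤ 2 * C * (1 + t ^ 2)⁻¹ * (1 + |t|) ^ 2 := by
          refine mul_le_mul_of_nonneg_left (by linarith) (by positivity)
  have hck : ∀ k : ℤ, Integrable fun t => c (t - k) := fun k => hci.comp_sub_right k
  -- the test function `g = φ / m` and `ψ = 𝓕 g`
  set g : ℝ → ℂ := fun ξ => φ ξ * (𝓕 c ξ)⁻¹ with hg_def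
  have hg : ContDiff ℝ 2 g := contDiff_div_of_tsupport_subset hJ hφ hφJ hm hm0
  have hgs : HasCompactSupport g := hasCompactSupport_div hφs
  have hgi : Integrable g := hg.continuous.integrable_of_hasCompactSupport hgs
  obtain ⟨hψi, hψc⟩ := integrable_fourier_of_contDiff_two hg hgs
  -- test the identity against `ψ`
  have hmain := hasSum_mul_integral_shift (ψ := 𝓕 g) hu hc hcd hψi hsum
  -- identify `∫ ψ(t) c(t − k) dt` with `𝓕 φ k`
  have hid : ∀ k : ℤ, ∫ t, 𝓕 g t * c (t - k) = 𝓕 φ k := by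
    intro k
    rw [integral_fourier_mul_eq (fun t => c (t - k)) g (hck k) hgi]
    have h2 : ∀ x, g x * 𝓕 (fun t => c (t - k)) x = 𝐞 (-(x * k)) • φ x := by
      intro x
      rw [fourier_comp_sub_const, Circle.smul_def, smul_eq_mul]
      by_cases hx : x ∈ J
      · rw [hg_def]
        simp only
        calc φ x * (𝓕 c x)⁻¹ * ((𝐞 (-(x * k)) : ℂ) * 𝓕 c x)
            = (𝐞 (-(x * k)) : ℂ) * φ x * ((𝓕 c x)⁻¹ * 𝓕 c x) := by ring
          _ = (𝐞 (-(x * k)) : ℂ) * φ x := by rw [inv_mul_cancel₀ (hm0 x hx), mul_one]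
      · have hx' : x ∉ tsupport φ := fun h => hx (hφJ h)
        have : φ x = 0 := image_eq_zero_of_notMem_tsupport hx'
        rw [hg_def]
        simp [this]
    simp_rw [h2]
    rw [Real.fourier_real_eq]
  simp_rw [hid] at hmain
  exact hmain

/-- **Annihilation on an integer translate of a good set.**  Same, with `tsupport φ ⊆ n + J`
(`= (· + n) '' J`) for an integer `n`: integer translation does not change `𝓕φ` at integers.
[folklore] -/
theorem hasSum_mul_fourier_of_tsupport_subset_add_int {u : ℤ → ℂ} {c : ℝ → ℂ} {M C : ℝ}
    (hu : ∀ k, ‖u k‖ ≤ M) (hc : Continuous c) (hcd : ∀ t : ℝ, ‖c t‖ ≤ C / (1 + |t|) ^ 2)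
    (hsum : ∀ t : ℝ, HasSum (fun k : ℤ => u k * c (t - k)) 0)
    {J : Set ℝ} (hJ : IsOpen J) (hm : ContDiffOn ℝ 2 (𝓕 c) J) (hm0 : ∀ ξ ∈ J, 𝓕 c ξ ≠ 0)
    (n : ℤ) {φ : ℝ → ℂ} (hφ : ContDiff ℝ 2 φ) (hφs : HasCompactSupport φ)
    (hφJ : tsupport φ ⊆ (fun ξ => ξ + n) '' J) :
    HasSum (fun k : ℤ => u k * 𝓕 φ k) 0 := by
  -- the translate `φ (· + n)` is supported in `J`
  set φ' : ℝ → ℂ := fun t => φ (t + n) with hφ'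
  have hφ'd : ContDiff ℝ 2 φ' := hφ.comp (contDiff_id.add contDiff_const)
  have hφ's : HasCompactSupport φ' := hφs.comp_homeomorph (Homeomorph.addRight (n : ℝ))
  have hφ'J : tsupport φ' ⊆ J := by
    intro x hx
    have hx' : x + n ∈ tsupport φ := by
      have := (tsupport_comp_eq_preimage φ (Homeomorph.addRight (n : ℝ))) ▸ hx
      simpa using this
    obtain ⟨y, hy, hyx⟩ := hφJ hx'
    have : y = x := by
      have : y + n = x + n := hyx
      linarith
    rwa [← this]
  have h := hasSum_mul_fourier_of_tsupport_subset hu hc hcd hsum hJ hm hm0 hφ'd hφ's hφ'J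
  have hF : ∀ k : ℤ, 𝓕 φ' k = 𝓕 φ k := fun k => fourier_comp_add_int φ n k
  simp_rw [hF] at h
  exact h

/-! # PART C1 — splitting a test function over the half-integer grid -/

/-- The open half-interval `(m/2, (m+1)/2)`. [folklore] -/
def halfInt (m : ℤ) : Set ℝ := Set.Ioo ((m : ℝ) / 2) (((m : ℝ) + 1) / 2)

/-- `halfInt m` is open. [folklore] -/
theorem isOpen_halfInt (m : ℤ) : IsOpen (halfInt m) := isOpen_Ioo

/-- A real number off the half-integer grid lies in the half-interval of `⌊2x⌋`. [folklore] -/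
theorem mem_halfInt_floor {x : ℝ} (hx : ∀ m : ℤ, x ≠ m / 2) : x ∈ halfInt ⌊2 * x⌋ := by
  have h1 : (⌊2 * x⌋ : ℝ) ≤ 2 * x := Int.floor_le _
  have h2 : 2 * x < ⌊2 * x⌋ + 1 := Int.lt_floor_add_one _
  have h3 : (⌊2 * x⌋ : ℝ) ≠ 2 * x := fun h => hx ⌊2 * x⌋ (by linarith)
  refine ⟨?_, ?_⟩
  · have : (⌊2 * x⌋ : ℝ) < 2 * x := lt_of_le_of_ne h1 h3
    linarith
  · linarith

/-- Two half-intervals containing a common point coincide. [folklore] -/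
theorem eq_of_mem_halfInt {x : ℝ} {m m' : ℤ} (hm : x ∈ halfInt m) (hm' : x ∈ halfInt m') : m = m' := by
  obtain ⟨h1, h2⟩ := hm
  obtain ⟨h3, h4⟩ := hm'
  have a : (m : ℝ) < m' + 1 := by linarith
  have b : (m' : ℝ) < m + 1 := by linarith
  have a' : m < m' + 1 := by exact_mod_cast a
  have b' : m' < m + 1 := by exact_mod_cast b
  omega

/-- The endpoints of `halfInt m` are half-integers: a point of the closed half-interval which is
not on the grid lies in the open one. [folklore] -/
theorem mem_halfInt_of_mem_Icc {x : ℝ} {m : ℤ} (hx : ∀ m : ℤ, x ≠ m / 2)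
    (h : x ∈ Set.Icc ((m : ℝ) / 2) (((m : ℝ) + 1) / 2)) : x ∈ halfInt m := by
  refine ⟨lt_of_le_of_ne h.1 fun h' => hx m h'.symm, lt_of_le_of_ne h.2 fun h' => hx (m + 1) ?_⟩
  rw [h']; push_cast; ring

/-- Even half-intervals are integer translates of `(−1, −1/2)`. [folklore] -/
theorem halfInt_two_mul (n : ℤ) :
    halfInt (2 * n) = (fun ξ : ℝ => ξ + ((n + 1 : ℤ) : ℝ)) '' Set.Ioo (-1) (-(1 / 2)) := by
  rw [Set.image_add_const_Ioo, halfInt]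
  congr 1 <;> push_cast <;> ring

/-- Odd half-intervals are integer translates of `(1/2, 1)`. [folklore] -/
theorem halfInt_two_mul_add_one (n : ℤ) :
    halfInt (2 * n + 1) = (fun ξ : ℝ => ξ + ((n : ℤ) : ℝ)) '' Set.Ioo (1 / 2) 1 := by
  rw [Set.image_add_const_Ioo, halfInt]
  congr 1 <;> push_cast <;> ring

section Pieces

variable {φ : ℝ → ℂ}

/-- The piece of `φ` on `halfInt m`. [folklore] -/
def piece (φ : ℝ → ℂ) (m : ℤ) : ℝ → ℂ := (halfInt m).indicator φ

/-- Off the grid-avoiding support, a piece vanishes near every point outside its half-interval.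
[folklore] -/
theorem piece_eventuallyEq_zero (hφO : ∀ x ∈ tsupport φ, ∀ m : ℤ, x ≠ m / 2) {m : ℤ} {x : ℝ}
    (hx : x ∉ halfInt m) : piece φ m =ᶠ[𝓝 x] fun _ => 0 := by
  by_cases hgrid : x ∈ Set.Icc ((m : ℝ) / 2) (((m : ℝ) + 1) / 2)
  · -- `x` is an endpoint, hence a grid point, hence outside `tsupport φ`
    have hxt : x ∉ tsupport φ := fun h => hx (mem_halfInt_of_mem_Icc (hφO x h) hgrid)
    have h0 : φ =ᶠ[𝓝 x] 0 := notMem_tsupport_iff_eventuallyEq.mp hxt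
    filter_upwards [h0] with y hy
    simp [piece, hy]
  · have hopen : IsOpen (Set.Icc ((m : ℝ) / 2) (((m : ℝ) + 1) / 2))ᶜ := isClosed_Icc.isOpen_compl
    filter_upwards [hopen.mem_nhds hgrid] with y hy
    have hy' : y ∉ halfInt m := fun h => hy (Set.Ioo_subset_Icc_self h)
    simp [piece, Set.indicator_of_notMem hy']

/-- Each piece of a grid-avoiding `C²` function is `C²`. [folklore] -/
theorem contDiff_piece (hφ : ContDiff ℝ 2 φ) (hφO : ∀ x ∈ tsupport φ, ∀ m : ℤ, x ≠ m / 2) (m : ℤ) :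
    ContDiff ℝ 2 (piece φ m) := by
  refine contDiff_iff_contDiffAt.2 fun x => ?_
  by_cases hx : x ∈ halfInt m
  · have h1 : piece φ m =ᶠ[𝓝 x] φ := by
      filter_upwards [(isOpen_halfInt m).mem_nhds hx] with y hy
      simp [piece, Set.indicator_of_mem hy]
    exact hφ.contDiffAt.congr_of_eventuallyEq h1
  · exact (contDiffAt_const (c := (0 : ℂ))).congr_of_eventuallyEq (piece_eventuallyEq_zero hφO hx)

/-- Each piece has compact support. [folklore] -/
theorem hasCompactSupport_piece (hφs : HasCompactSupport φ) (m : ℤ) :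
    HasCompactSupport (piece φ m) :=
  hφs.mono (by rw [piece, Set.support_indicator]; exact Set.inter_subset_right)

/-- The topological support of a piece lies in its (open) half-interval. [folklore] -/
theorem tsupport_piece_subset (hφO : ∀ x ∈ tsupport φ, ∀ m : ℤ, x ≠ m / 2) (m : ℤ) :
    tsupport (piece φ m) ⊆ halfInt m := by
  intro x hx
  by_contra hxm
  have h0 := piece_eventuallyEq_zero hφO hxm
  exact (notMem_tsupport_iff_eventuallyEq.mpr h0) hx

/-- **A grid-avoiding `C_c²` function is the finite sum of its pieces**: with `tsupport φ ⊆ [−R, R]`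
and `N ≥ 2R + 1`, `φ = Σ_{|m| ≤ N} piece φ m`. [folklore] -/
theorem eq_sum_piece (hφO : ∀ x ∈ tsupport φ, ∀ m : ℤ, x ≠ m / 2) {R : ℝ}
    (hR : tsupport φ ⊆ Metric.closedBall 0 R) {N : ℤ} (hN : 2 * R + 1 ≤ N) (x : ℝ) :
    φ x = ∑ m ∈ Finset.Icc (-N) N, piece φ m x := by
  classical
  by_cases hxt : x ∈ tsupport φ
  · have hxg := hφO x hxt
    set m₀ : ℤ := ⌊2 * x⌋ with hm₀
    have hm₀x : x ∈ halfInt m₀ := mem_halfInt_floor hxg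
    have hxR : |x| ≤ R := by
      have := hR hxt
      rwa [Metric.mem_closedBall, dist_zero_right, Real.norm_eq_abs] at this
    have hm₀F : m₀ ∈ Finset.Icc (-N) N := by
      rw [Finset.mem_Icc]
      have h1 : (m₀ : ℝ) ≤ 2 * x := Int.floor_le _
      have h2 : 2 * x < m₀ + 1 := Int.lt_floor_add_one _
      have hx1 := (abs_le.1 hxR).1
      have hx2 := (abs_le.1 hxR).2
      constructor
      · have : (-N : ℝ) ≤ m₀ := by linarith
        exact_mod_cast this
      · have : (m₀ : ℝ) ≤ N := by linarith
        exact_mod_cast this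
    rw [Finset.sum_eq_single_of_mem m₀ hm₀F]
    · simp [piece, Set.indicator_of_mem hm₀x]
    · intro m _ hm
      have : x ∉ halfInt m := fun h => hm (eq_of_mem_halfInt h hm₀x)
      simp [piece, Set.indicator_of_notMem this]
  · have h0 : φ x = 0 := image_eq_zero_of_notMem_tsupport hxt
    rw [h0, eq_comm]
    refine Finset.sum_eq_zero fun m _ => ?_
    simp [piece, Set.indicator_apply, h0]

end Pieces

/-- **Annihilation for grid-avoiding test functions.**  Under the standing hypotheses on `u, c`
(`h = 1`: `𝓕c` is `C²` and zero-free on `(1/2, 1) ∪ (−1, −1/2)`), `Σ_k u_k 𝓕φ(k) = 0` for every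
`C_c²` function `φ` whose topological support avoids the half-integer grid `½ℤ`. [folklore] -/
theorem hasSum_mul_fourier_of_avoid_grid {u : ℤ → ℂ} {c : ℝ → ℂ} {M C : ℝ}
    (hu : ∀ k, ‖u k‖ ≤ M) (hc : Continuous c) (hcd : ∀ t : ℝ, ‖c t‖ ≤ C / (1 + |t|) ^ 2)
    (hsum : ∀ t : ℝ, HasSum (fun k : ℤ => u k * c (t - k)) 0)
    (hm : ContDiffOn ℝ 2 (𝓕 c) (Set.Ioo (1 / 2 : ℝ) 1 ∪ Set.Ioo (-1 : ℝ) (-(1 / 2))))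
    (hm0 : ∀ ξ ∈ Set.Ioo (1 / 2 : ℝ) 1 ∪ Set.Ioo (-1 : ℝ) (-(1 / 2)), 𝓕 c ξ ≠ 0)
    {φ : ℝ → ℂ} (hφ : ContDiff ℝ 2 φ) (hφs : HasCompactSupport φ)
    (hφO : ∀ x ∈ tsupport φ, ∀ m : ℤ, x ≠ m / 2) :
    HasSum (fun k : ℤ => u k * 𝓕 φ k) 0 := by
  classical
  -- good sets
  have hJp : IsOpen (Set.Ioo (1 / 2 : ℝ) 1) := isOpen_Ioo
  have hJm : IsOpen (Set.Ioo (-1 : ℝ) (-(1 / 2))) := isOpen_Ioo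
  have hmp : ContDiffOn ℝ 2 (𝓕 c) (Set.Ioo (1 / 2 : ℝ) 1) := hm.mono Set.subset_union_left
  have hmm : ContDiffOn ℝ 2 (𝓕 c) (Set.Ioo (-1 : ℝ) (-(1 / 2))) := hm.mono Set.subset_union_right
  have hm0p : ∀ ξ ∈ Set.Ioo (1 / 2 : ℝ) 1, 𝓕 c ξ ≠ 0 := fun ξ hξ => hm0 ξ (Or.inl hξ)
  have hm0m : ∀ ξ ∈ Set.Ioo (-1 : ℝ) (-(1 / 2)), 𝓕 c ξ ≠ 0 := fun ξ hξ => hm0 ξ (Or.inr hξ)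
  -- each piece is annihilated
  have hpiece : ∀ m : ℤ, HasSum (fun k : ℤ => u k * 𝓕 (piece φ m) k) 0 := by
    intro m
    have hd := contDiff_piece hφ hφO m
    have hs := hasCompactSupport_piece hφs m
    have ht := tsupport_piece_subset hφO m
    rcases Int.even_or_odd' m with ⟨n, rfl | rfl⟩
    · rw [halfInt_two_mul] at ht
      exact hasSum_mul_fourier_of_tsupport_subset_add_int hu hc hcd hsum hJm hmm hm0m (n + 1) hd hs ht
    · rw [halfInt_two_mul_add_one] at ht
      exact hasSum_mul_fourier_of_tsupport_subset_add_int hu hc hcd hsum hJp hmp hm0p n hd hs ht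
  -- `φ` is the finite sum of its pieces
  obtain ⟨R, hR⟩ := hφs.isCompact.isBounded.subset_closedBall (0 : ℝ)
  set N : ℤ := ⌈2 * R + 1⌉ with hN
  have hNR : 2 * R + 1 ≤ N := Int.le_ceil _
  -- linearity of `𝓕` over the finite sum (each piece is integrable)
  have hint : ∀ m : ℤ, Integrable (piece φ m) := fun m =>
    (contDiff_piece hφ hφO m).continuous.integrable_of_hasCompactSupport (hasCompactSupport_piece hφs m)
  have hF : ∀ k : ℤ, 𝓕 φ k = ∑ m ∈ Finset.Icc (-N) N, 𝓕 (piece φ m) k := by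
    intro k
    have hint' : ∀ m ∈ Finset.Icc (-N) N,
        Integrable (fun v : ℝ => 𝐞 (-(v * (k : ℝ))) • piece φ m v) := fun m _ => by
      have h := (Real.fourierIntegral_convergent_iff (μ := volume) (f := piece φ m) (k : ℝ)).2
        (hint m)
      simp only [Real.inner_apply] at h
      simpa [mul_comm] using h
    calc 𝓕 φ k = ∫ v : ℝ, 𝐞 (-(v * (k : ℝ))) • φ v := Real.fourier_real_eq _ _
      _ = ∫ v : ℝ, ∑ m ∈ Finset.Icc (-N) N, 𝐞 (-(v * (k : ℝ))) • piece φ m v := by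
          congr 1
          funext v
          rw [eq_sum_piece hφO hR hNR v, Finset.smul_sum]
      _ = ∑ m ∈ Finset.Icc (-N) N, ∫ v : ℝ, 𝐞 (-(v * (k : ℝ))) • piece φ m v :=
          integral_finsetSum _ hint'
      _ = ∑ m ∈ Finset.Icc (-N) N, 𝓕 (piece φ m) k := by
          simp only [Real.fourier_real_eq]
  simp_rw [hF, Finset.mul_sum]
  have := hasSum_sum (s := Finset.Icc (-N) N) fun m _ => hpiece m
  simpa using this

/-- Anchor of this helper file (registered obligation): the half-intervals are open. [folklore] -/
theorem rodLemmaB_anchor : ∀ m : ℤ, IsOpen (halfInt m) := isOpen_halfInt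

end Summit.AtomisticToContinuum.Crystallization.Theorems.SignedRootRodLemma

end
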